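import Literature.AlgebraicGeometry.Motives.AbelianVarietyIsogenyProofs
import HarnessLib

/-!
# A strict dimension inequality along closed maps with a non-trivial generic fibre

Topic: `Literature/AlgebraicGeometry/Resolution`. Bookkeeping for de Jong 1996, 4.22 ("At this
point we apply the induction hypothesis" to the base `(Y, D)` of the curve `𝒞 → Y`, which needs
`dim Y ≤ dim 𝒞 - 1`): the elementary half of the relative-dimension formula, in topological form.
If a continuous closed (more generally: specializing) map `f : X → Y` of sober `T₀` spaces hits
the generic point `η` of `Y` in a point `a` which is a proper specialization of another point
`a⁺` of `X` (e.g. `X` irreducible and the generic fibre `f⁻¹(η)` not reduced to the generic point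
of `X`), then `dim Y + 1 ≤ dim X`: a chain of specializations of `Y` ends below `η`, lifts along
`f` to a chain of `X` ending at `a` (going up, `Literature.AlgebraicGeometry.Motives.Order.
exists_ltSeries_length_eq_of_fibration`), and is prolonged by `a⁺`. Everything is proved; for
schemes: `topologicalKrullDim_base_add_one_le` (a universally closed morphism from an integral
scheme onto an irreducible scheme whose generic fibre has a point other than the generic point).

## Sources

* A. J. de Jong, *Smoothness, semi-stability and alterations*, Publ. Math. IHÉS 83 (1996), 4.22
  (p. 74: the induction hypothesis is applied to `Y`, `dim Y = dim X - 1`).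
* The Stacks Project, Tag 00GU (Lemma 10.36.22: going up and lifting of chains) — the argument
  here is its elementary order-theoretic content on the specialization order
  (`Literature/AlgebraicGeometry/Motives/AbelianVarietyIsogenyProofs.lean`).
-/

noncomputable section

open Order TopologicalSpace Topology

namespace Literature.AlgebraicGeometry.Resolution

universe u

/-! ## Order theory: heights lift along fibrations -/

section OrderTheory

variable {α β : Type*} [Preorder α] [Preorder β]

/-- **Heights do not drop along a fibration**: if `f : α → β` lifts strict inequalities below its
values (for every `b < f a` there is `a' < a` with `f a' = b`), then `height (f a) ≤ height a` —
every chain ending at `f a` lifts to a chain of the same length ending at `a`. [folklore] -/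
theorem height_apply_le_of_fibration (f : α → β)
    (hf : ∀ ⦃a : α⦄ ⦃b : β⦄, b < f a → ∃ a' < a, f a' = b) (a : α) :
    height (f a) ≤ height a := by
  refine height_le fun p hp => ?_
  obtain ⟨q, hq, hqlast⟩ :=
    Literature.AlgebraicGeometry.Motives.Order.exists_ltSeries_length_eq_of_fibration f hf p
      (a := a) hp.symm
  have h := Order.length_le_height_last (p := q)
  rw [hqlast, hq] at h
  exact h

/-- If `f : α → β` is a fibration in the above sense, `f a` is a top element of `β`, and `a < a⁺`,
then `krullDim β + 1 ≤ krullDim α`. [folklore] -/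
theorem krullDim_add_one_le_of_fibration_of_isTop (f : α → β)
    (hf : ∀ ⦃a : α⦄ ⦃b : β⦄, b < f a → ∃ a' < a, f a' = b) {a a' : α} (haa' : a < a')
    (htop : IsTop (f a)) : krullDim β + 1 ≤ krullDim α := by
  -- `krullDim β = height (f a)` since `f a` is a top element
  have h1 : krullDim β = (height (f a) : WithBot ℕ∞) := by
    refine le_antisymm ?_ (height_le_krullDim _)
    refine iSup_le fun p => ?_
    have hlast : p.last ≤ f a := htop _
    exact_mod_cast (Order.length_le_height_last (p := p)).trans (height_mono hlast)
  have h2 : height (f a) + 1 ≤ height a' :=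
    (add_le_add (height_apply_le_of_fibration f hf a) le_rfl).trans (height_add_one_le haa')
  rw [h1]
  calc (height (f a) : WithBot ℕ∞) + 1 = ((height (f a) + 1 : ℕ∞) : WithBot ℕ∞) := by norm_cast
    _ ≤ height a' := by exact_mod_cast h2
    _ ≤ krullDim α := height_le_krullDim _

end OrderTheory

/-! ## Topology: a closed map with a non-trivial generic fibre raises the dimension -/

section Topology

variable {X Y : Type*} [TopologicalSpace X] [TopologicalSpace Y]

attribute [local instance] specializationOrder

/-- **`dim Y + 1 ≤ dim X` for a specializing map with a non-trivial fibre over the generic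
point.** Let `f : X → Y` be a specializing map (e.g. continuous and closed) of sober
`T₀` spaces, `η` a generic point of `Y` (it specializes to every point), `a ∈ f⁻¹(η)` and
`a⁺ ⤳ a` a proper generization of `a` in `X`. Then `dim Y + 1 ≤ dim X`: chains of `Y` may be
taken to end at `η`, lift along `f` to chains ending at `a`, and are prolonged by `a⁺`
(continuity of `f` is not needed). [folklore] -/
theorem topologicalKrullDim_add_one_le_of_specializingMap [QuasiSober X] [T0Space X]
    [QuasiSober Y] [T0Space Y] {f : X → Y} (hs : SpecializingMap f)
    {η : Y} (hη : ∀ y, η ⤳ y) {a a' : X} (ha : f a = η) (ha' : a' ⤳ a) (hne : a' ≠ a) :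
    topologicalKrullDim Y + 1 ≤ topologicalKrullDim X := by
  rw [Literature.AlgebraicGeometry.Motives.topologicalKrullDim_eq_krullDim_specializationOrder,
    Literature.AlgebraicGeometry.Motives.topologicalKrullDim_eq_krullDim_specializationOrder]
  have hfib : ∀ ⦃x : X⦄ ⦃y : Y⦄, y < f x → ∃ x' < x, f x' = y := by
    intro x y hy
    obtain ⟨x', hx', rfl⟩ := hs hy.le
    refine ⟨x', lt_of_le_of_ne hx' ?_, rfl⟩
    rintro rfl
    exact lt_irrefl _ hy
  have hlt : a < a' := by
    refine lt_of_le_of_ne ha' ?_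
    rintro rfl
    exact hne rfl
  have htop : IsTop (f a) := fun y => by
    rw [ha]
    exact hη y
  exact krullDim_add_one_le_of_fibration_of_isTop f hfib hlt htop

end Topology

/-! ## Schemes -/

section Schemes

open _root_.AlgebraicGeometry CategoryTheory

/-- **`dim Y + 1 ≤ dim X` for a universally closed morphism with a non-trivial generic fibre**:
if `f : X ⟶ Y` is universally closed (e.g. proper), `X` is irreducible, `Y` is irreducible, and
the fibre of `f` over the generic point of `Y` contains a point other than the generic point of
`X`, then `dim Y + 1 ≤ dim X` (topological Krull dimensions). [folklore] -/
theorem topologicalKrullDim_base_add_one_le {X Y : Scheme.{u}} (f : X ⟶ Y) [UniversallyClosed f]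
    [IrreducibleSpace X] [IrreducibleSpace Y] {b : X} (hb : f b = genericPoint Y)
    (hne : b ≠ genericPoint X) : topologicalKrullDim Y + 1 ≤ topologicalKrullDim X :=
  topologicalKrullDim_add_one_le_of_specializingMap f.isClosedMap.specializingMap
    (η := genericPoint Y) (fun y => genericPoint_specializes y) hb (genericPoint_specializes b)
    (Ne.symm hne)

end Schemes

end Literature.AlgebraicGeometry.Resolution

end
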